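import Summits.NavierStokesRegularity.NavierStokesRegularity.Theorems.TypeICertificateLadderNoTypeIBlowupLemma35

/-!
# Route TypeICertificateLadder — crux `TypeIConcentration` (item stmt-NavierStokesRegularity-2881):
# Seregin–Šverák's Lemma 3.5 in DECAYING form — on small scales the scaled energies of a Type I
# suitable weak solution are bounded by a constant depending on the Type I constant ONLY

Helper file (theorems only) of the line `bp-scaled-energy` for the crux `TypeIConcentration`.
The symmetry-free quantitative Lemma 3.5 of the tree
(`scaledEnergy_vertex_le_of_typeI`, `TypeICertificateLadderNoTypeIBlowupLemma35.lean`) bounds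
`A + E + C + D` at the vertex of the unit cylinder AFFINELY in the unit-scale data
`X = A(0, 3/4) + E(0, 3/4) + D(0, 1)`. Its engine is a CONTRACTION in the scale,
`ℰ(ϑ r) ≤ ½ ℰ(r) + B` (`SereginSverak2009.decay_step_half`), so the influence of the data decays
geometrically: after `n` halvings `ℰ ≤ 2⁻ⁿ M + 2B` (`iterate_halving_pow` below), and on all
scales `0 < r < ϑⁿ/4` with `2⁻ⁿ M ≤ 1` the scaled energies are bounded by `d = d(K)`, a constant
depending on the Type I constant `K` only — the range of scales, not the bound, depends on the
data (`stub_scaledEnergyVertexEventually`, the registered stub of the line's skeleton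
`Cruxes/TypeIConcentration/Lines/bp-scaled-energy.lean`).

Read at every centre through the unit-cylinder zoom of a classical Leray–Hopf solution with the
eventual rate `√(T−t)‖u‖ ≤ C√ν` (`zoom_unitCyl_data`: Type I constant EXACTLY `C`, data bounded
by the global energy, dissipation and slab `L^{3/2}` pressure norm — finite, solution-dependent),
this is the UNIFORM Morrey bound of support item `ScaledEnergyBound` (stmt-…-2884: constant
`A(C)`, solution-dependent radius `r₀`), whence the crux by Barker–Prange 2020 Thm 2
(sibling files `…TypeIConcentrationOfScaledEnergy.lean`, `…TypeIConcentration.lean`).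

References: G. Seregin, V. Šverák, Comm. PDE 34 (2009) = arXiv:0804.1803, Lemma 3.5 and its
proof (p. 10); T. Barker, C. Prange, arXiv:1812.09115, (e.typeI) and the remark p. 5.
-/

noncomputable section

namespace Summit.NavierStokesRegularity.NavierStokesRegularity.Theorems

open MeasureTheory Set Function Filter Topology TopologicalSpace Metric
open Literature.Analysis.FluidPDE Literature.Analysis.FluidPDE.SereginSverak2009
open scoped NNReal ENNReal

/-! ### The halving iteration with geometric decay of the data -/

/-- **Halving iteration, decaying form.** If `Φ(ϑ r) ≤ ½ Φ(r) + B` for `0 < r < R` and `Φ ≤ M`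
on `[r₀, R)` with `0 < r₀ ≤ ϑ R`, `0 < ϑ < 1`, then after `n` further halvings
`Φ(r) ≤ 2⁻ⁿ M + 2B` for all `0 < r < ϑⁿ R` (induction on `n`; the case `n = 0` is the tree's
`iterate_halving`). [cite: SereginSverak2009, proof of Lemma 3.5 (arXiv p. 10)] -/
theorem iterate_halving_pow {Φ : ℝ → ℝ≥0∞} {ϑ r₀ R : ℝ} {B M : ℝ≥0∞} (hϑ : 0 < ϑ) (hϑ1 : ϑ < 1)
    (hr₀ : 0 < r₀) (hr₀R : r₀ ≤ ϑ * R)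
    (hstep : ∀ r, 0 < r → r < R → Φ (ϑ * r) ≤ 2⁻¹ * Φ r + B)
    (htop : ∀ r, r₀ ≤ r → r < R → Φ r ≤ M) (n : ℕ) :
    ∀ r, 0 < r → r < ϑ ^ n * R → Φ r ≤ (2⁻¹) ^ n * M + 2 * B := by
  induction n with
  | zero =>
    intro r hr hrR
    rw [pow_zero, one_mul] at hrR
    rw [pow_zero, one_mul]
    exact iterate_halving hϑ hϑ1 hr₀ hr₀R hstep htop hr hrR
  | succ k ih =>
    intro r hr hrR
    have hR : 0 < R := by
      have h1 : 0 < ϑ ^ (k + 1) * R := hr.trans hrR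
      exact pos_of_mul_pos_right h1 (pow_nonneg hϑ.le _)
    have hr' : r / ϑ < ϑ ^ k * R := by
      rw [div_lt_iff₀ hϑ]
      calc r < ϑ ^ (k + 1) * R := hrR
        _ = ϑ ^ k * R * ϑ := by ring
    have hr'R : r / ϑ < R := by
      refine hr'.trans_le ?_
      calc ϑ ^ k * R ≤ 1 * R :=
            mul_le_mul_of_nonneg_right (pow_le_one₀ hϑ.le hϑ1.le) hR.le
        _ = R := one_mul R
    have h1 := ih (r / ϑ) (div_pos hr hϑ) hr'
    have h2 := hstep (r / ϑ) (div_pos hr hϑ) hr'R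
    have e : ϑ * (r / ϑ) = r := by field_simp
    rw [e] at h2
    calc Φ r ≤ 2⁻¹ * Φ (r / ϑ) + B := h2
      _ ≤ 2⁻¹ * ((2⁻¹) ^ k * M + 2 * B) + B := by gcongr
      _ = (2⁻¹) ^ (k + 1) * M + (2⁻¹ * 2 * B + B) := by ring
      _ = (2⁻¹) ^ (k + 1) * M + 2 * B := by
          rw [ENNReal.inv_mul_cancel two_ne_zero ENNReal.ofNat_ne_top, one_mul, two_mul]

/-- A geometric factor beating a finite `M`: for `M ≠ ⊤` there is `n` with `2⁻ⁿ M ≤ 1`.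
[folklore] -/
theorem exists_inv_two_pow_mul_le_one {M : ℝ≥0∞} (hM : M ≠ ⊤) :
    ∃ n : ℕ, (2⁻¹ : ℝ≥0∞) ^ n * M ≤ 1 := by
  rcases eq_or_ne M 0 with rfl | hM0
  · exact ⟨0, by simp⟩
  obtain ⟨n, hn⟩ := ENNReal.exists_inv_two_pow_lt (ENNReal.inv_ne_zero.2 hM)
  refine ⟨n, ?_⟩
  calc (2⁻¹ : ℝ≥0∞) ^ n * M ≤ M⁻¹ * M := mul_le_mul' hn.le le_rfl
    _ = 1 := ENNReal.inv_mul_cancel hM0 hM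

/-! ### Lemma 3.5 at the vertex, decaying form: a `K`-only bound on small scales -/

/-- **Seregin–Šverák 2009, Lemma 3.5 at the vertex — eventual form with a bound depending on the
Type I constant only** (registered stub `stub_scaledEnergyVertexEventually` of the line
`bp-scaled-energy` for the crux `TypeIConcentration`). For every `K` there is `d = d(K) ∈ ℝ≥0`
such that for every FINITE data level `M'` there is a scale `r₁ = r₁(K, M') ∈ (0, 1/4]` with:
for every suitable weak solution `(v, q)` of unit-viscosity Navier–Stokes in the unit cylinder
`Q(0, 1)` with `v ∈ L³(Q)`, weak spatial gradient `G`, the a.e. Type I bound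
`√(-t)|v(t, x)| ≤ K`, and unit-scale data `A(0, 3/4; v) + E(0, 3/4; G) + D(0, 1; q) ≤ M'`,
one has `A(0, r; v) + E(0, r; G) + C(0, r; v) + D(0, r; q) ≤ d` for all `0 < r < r₁`.
Proof: the printed iteration exactly as in `scaledEnergy_vertex_le_of_typeI` ((as11)
`cubicC_absorb_vertex`, (as12) `dissipationE_add_energyA_le_of_suitable`, (as13)
`pressureD_decay_vertex`, contraction `decay_step_half` with ratio `ϑ` and `K`-only constant
`B`), but iterated `n` more times (`iterate_halving_pow`) with `n` chosen so that `2⁻ⁿ a₀ M' ≤ 1`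
(`a₀ M'` the top-scale bound): `E + A + D ≤ 1 + 2B` on `(0, ϑⁿ/4)`, then (as11) once more for `C`;
`d = (1 + ε)(1 + 2B) + F`. [cite: SereginSverak2009, Lemma 3.5 and its proof (arXiv pp. 9–10)] -/
theorem stub_scaledEnergyVertexEventually (K : ℝ) :
    ∃ d : ℝ≥0, ∀ M' : ℝ≥0∞, M' ≠ ⊤ → ∃ r₁ : ℝ, 0 < r₁ ∧ r₁ ≤ 1 / 4 ∧
      ∀ (v : ℝ → EuclideanSpace ℝ (Fin 3) → EuclideanSpace ℝ (Fin 3))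
        (q : ℝ → EuclideanSpace ℝ (Fin 3) → ℝ)
        (G : ℝ → EuclideanSpace ℝ (Fin 3) → EuclideanSpace ℝ (Fin 3) →L[ℝ] EuclideanSpace ℝ (Fin 3)),
        IsSuitableWeakSolutionOn (parCylOpens 0 1) 1 0 v q →
        (∫⁻ z in parCyl 0 1, ‖v z.1 z.2‖ₑ ^ (3 : ℕ) < ∞) →
        HasWeakSpatialGradientOn (parCylOpens 0 1) v G →
        (∀ᵐ z ∂(volume.restrict (parCyl 0 1)), Real.sqrt (-z.1) * ‖v z.1 z.2‖ ≤ K) →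
        energyA 0 (3 / 4) v + dissipationE 0 (3 / 4) G + pressureD 0 1 q ≤ M' →
        ∀ r ∈ Ioo (0 : ℝ) r₁,
          energyA 0 r v + dissipationE 0 r G + cubicC 0 r v + pressureD 0 r q ≤ d := by
  obtain ⟨c₁₂, h12⟩ := dissipationE_add_energyA_le_of_suitable
  obtain ⟨c₁₃, h13⟩ := pressureD_decay_vertex
  -- constants depending on `c₁₂, c₁₃` only
  set L : ℝ≥0 := max c₁₂ c₁₃ with hL
  have hL12 : (c₁₂ : ℝ≥0∞) ≤ L := ENNReal.coe_le_coe.2 (le_max_left _ _)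
  have hL13 : (c₁₃ : ℝ≥0∞) ≤ L := ENNReal.coe_le_coe.2 (le_max_right _ _)
  obtain ⟨ϑ, hϑ0, hϑ4, hLϑ⟩ := exists_ratio (2 * L ^ 2 + L)
  obtain ⟨ε, hε0, hLε⟩ := exists_parameter ((6 * L + L ^ 2) * (2 * ϑ)⁻¹ ^ 2)
  have hϑR : (0 : ℝ) < ϑ := by exact_mod_cast hϑ0
  have hϑR4 : 4 * (ϑ : ℝ) ≤ 1 := by exact_mod_cast hϑ4
  have hϑ1R : (ϑ : ℝ) < 1 := by linarith
  -- the Type I constant made `≥ 1`, the window `η` and the constant `F` of (as11)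
  set Kh : ℝ := max K 1 with hKh
  have hKh0 : 0 < Kh := lt_of_lt_of_le one_pos (le_max_right _ _)
  have hε0R : (0 : ℝ) < ε := by exact_mod_cast hε0
  set η : ℝ := min 1 ((ε : ℝ) / (2 * Kh)) with hη
  have hη0 : 0 < η := lt_min one_pos (by positivity)
  have hη1 : η ≤ 1 := min_le_left _ _
  have hKη : 2 * Kh * η ≤ ε := by
    calc 2 * Kh * η ≤ 2 * Kh * ((ε : ℝ) / (2 * Kh)) := by gcongr; exact min_le_right _ _
      _ = ε := by field_simp
  have hV : volume (ball (0 : EuclideanSpace ℝ (Fin 3)) 1) ≠ ⊤ := measure_ball_lt_top.ne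
  set V : ℝ≥0 := (volume (ball (0 : EuclideanSpace ℝ (Fin 3)) 1)).toNNReal with hVdef
  have hVcoe : (V : ℝ≥0∞) = volume (ball (0 : EuclideanSpace ℝ (Fin 3)) 1) :=
    ENNReal.coe_toNNReal hV
  set F : ℝ≥0 := Real.toNNReal (8 * Kh ^ 3 / η ^ 3) * V with hF
  have hFcoe :
      ENNReal.ofReal (8 * Kh ^ 3 / η ^ 3) * volume (ball (0 : EuclideanSpace ℝ (Fin 3)) 1) = F := by
    rw [hF, ENNReal.coe_mul, hVcoe]
    rfl
  have ha : ENNReal.ofReal (2 * Kh * η) ≤ ε := by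
    rw [← ENNReal.ofReal_coe_nnreal]; exact ENNReal.ofReal_le_ofReal hKη
  -- the top scales `r₀ ≤ r < 1/4`, `r₀ = ϑ/4`, and the affine coefficient `a₀`
  set r₀ : ℝ := (ϑ : ℝ) * (1 / 4) with hr₀
  have hr₀0 : 0 < r₀ := by positivity
  set B : ℝ≥0 := (6 * L + L ^ 2) * (2 * ϑ)⁻¹ ^ 2 * F + L * (2 * ϑ)⁻¹ ^ 2 with hB
  set a₀ : ℝ≥0 := Real.toNNReal ((3 / 4) / r₀) + Real.toNNReal ((1 / r₀) ^ 2) with ha₀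
  -- the `K`-only bound
  refine ⟨(1 + ε) * (1 + 2 * B) + F, ?_⟩
  -- the data level, the number of extra halvings and the eventual range of scales
  intro M' hM'
  have hMtop : (a₀ : ℝ≥0∞) * M' ≠ ⊤ := ENNReal.mul_ne_top ENNReal.coe_ne_top hM'
  obtain ⟨n, hn⟩ := exists_inv_two_pow_mul_le_one hMtop
  refine ⟨(ϑ : ℝ) ^ n * (1 / 4), by positivity, ?_, ?_⟩
  · calc (ϑ : ℝ) ^ n * (1 / 4) ≤ 1 * (1 / 4) :=
          mul_le_mul_of_nonneg_right (pow_le_one₀ hϑR.le hϑ1R.le) (by norm_num)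
      _ = 1 / 4 := one_mul _
  -- the solution
  intro v q G hsw hv3 hG hIK hdata r hr
  have hdist := hsw.distributional
  set z : ℝ × EuclideanSpace ℝ (Fin 3) := ((0 : ℝ), (0 : ℝ) • eZ) with hz
  have hz0 : z = 0 := by rw [hz, zero_smul]; rfl
  -- `r` is a small scale
  have hrn : r < (ϑ : ℝ) ^ n * (1 / 4) := hr.2
  have hr4 : r < 1 / 4 := by
    refine hrn.trans_le ?_
    calc (ϑ : ℝ) ^ n * (1 / 4) ≤ 1 * (1 / 4) :=
          mul_le_mul_of_nonneg_right (pow_le_one₀ hϑR.le hϑ1R.le) (by norm_num)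
      _ = 1 / 4 := one_mul _
  have hrI : r ∈ Ioo (0 : ℝ) (1 / 4) := ⟨hr.1, hr4⟩
  -- Type I with the constant `Kh ≥ K`, measurability, local integrability of `|v|³`
  have hI : ∀ᵐ w ∂(volume.restrict (parCyl 0 1)), Real.sqrt (-w.1) * ‖v w.1 w.2‖ ≤ Kh :=
    hIK.mono fun w hw => hw.trans (le_max_left _ _)
  have hvm : AEStronglyMeasurable (uncurry v) (volume.restrict (parCyl 0 1)) := by
    have := hdist.1.aestronglyMeasurable
    rwa [coe_parCylOpens] at this
  have hv3loc : LocallyIntegrableOn (fun w : ℝ × EuclideanSpace ℝ (Fin 3) => ‖v w.1 w.2‖ ^ 3)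
      ((parCylOpens 0 1 : Opens (ℝ × EuclideanSpace ℝ (Fin 3))) : Set (ℝ × EuclideanSpace ℝ (Fin 3)))
      volume := by
    refine IntegrableOn.locallyIntegrableOn ⟨?_, ?_⟩
    · rw [coe_parCylOpens]; exact hvm.norm.pow 3
    · rw [hasFiniteIntegral_iff_enorm, coe_parCylOpens]
      refine lt_of_le_of_lt (le_of_eq (lintegral_congr fun w => ?_)) hv3
      rw [Real.enorm_eq_ofReal (by positivity), ENNReal.ofReal_pow (norm_nonneg _), ofReal_norm]
  -- (as11) at all scales `(0, 1/4)`
  have h11 : ∀ s ∈ Ioo (0 : ℝ) (1 / 4), cubicC z s v ≤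
      ε * (dissipationE z s G + energyA z s v) + F := by
    intro s hs
    calc cubicC z s v ≤ ENNReal.ofReal (2 * Kh * η) * energyA z s v +
          ENNReal.ofReal (8 * Kh ^ 3 / η ^ 3) * volume (ball (0 : EuclideanSpace ℝ (Fin 3)) 1) :=
          cubicC_absorb_vertex hKh0.le hvm hI hη0 hη1 hs
      _ = ENNReal.ofReal (2 * Kh * η) * energyA z s v + F := by rw [hFcoe]
      _ ≤ ε * (dissipationE z s G + energyA z s v) + F :=
          add_le_add (mul_le_mul' ha le_add_self) le_rfl
  -- the top-scale bound `ℰ ≤ a₀ M'` on `[r₀, 1/4)`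
  have htop : ∀ s, r₀ ≤ s → s < 1 / 4 →
      dissipationE z s G + energyA z s v + pressureD z s q ≤ (a₀ : ℝ≥0∞) * M' := by
    intro s h1 h2
    have hs0 : 0 < s := hr₀0.trans_le h1
    have hbs : |(0 : ℝ)| + s ≤ 3 / 4 := by rw [abs_zero]; linarith
    have hbs1 : |(0 : ℝ)| + s ≤ 1 := by rw [abs_zero]; linarith
    have hsub := parCyl_axis_subset hs0.le hbs
    have hsub1 := parCyl_axis_subset hs0.le hbs1
    have hE : dissipationE z s G ≤ ENNReal.ofReal ((3 / 4) / r₀) * dissipationE 0 (3 / 4) G :=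
      (dissipationE_le_of_subset hs0 (by norm_num) hsub).trans (by gcongr)
    have hA : energyA z s v ≤ ENNReal.ofReal ((3 / 4) / r₀) * energyA 0 (3 / 4) v := by
      have ht : Ioo (z.1 - s ^ 2) z.1 ⊆
          Ioo ((0 : ℝ × EuclideanSpace ℝ (Fin 3)).1 - (3 / 4) ^ 2) (0 : ℝ × EuclideanSpace ℝ (Fin 3)).1 := by
        refine Ioo_subset_Ioo ?_ (by rw [hz0])
        rw [hz0]
        simp only [Prod.fst_zero]
        nlinarith
      have hx : spaceCyl z.2 s ⊆ spaceCyl (0 : ℝ × EuclideanSpace ℝ (Fin 3)).2 (3 / 4) :=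
        spaceCyl_axis_subset hbs
      exact (energyA_le_of_subset hs0 (by norm_num) ht hx).trans (by gcongr)
    have hD : pressureD z s q ≤ ENNReal.ofReal ((1 / r₀) ^ 2) * pressureD 0 1 q :=
      (pressureD_le_of_subset hs0 (by norm_num) hsub1).trans (by gcongr)
    have e1 : ENNReal.ofReal ((3 / 4) / r₀) ≤ (a₀ : ℝ≥0∞) := by
      show ((Real.toNNReal ((3 / 4) / r₀) : ℝ≥0) : ℝ≥0∞) ≤ _
      rw [ha₀, ENNReal.coe_add]
      exact le_self_add
    have e2 : ENNReal.ofReal ((1 / r₀) ^ 2) ≤ (a₀ : ℝ≥0∞) := by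
      show ((Real.toNNReal ((1 / r₀) ^ 2) : ℝ≥0) : ℝ≥0∞) ≤ _
      rw [ha₀, ENNReal.coe_add]
      exact le_add_self
    calc dissipationE z s G + energyA z s v + pressureD z s q
        ≤ ENNReal.ofReal ((3 / 4) / r₀) * dissipationE 0 (3 / 4) G +
          ENNReal.ofReal ((3 / 4) / r₀) * energyA 0 (3 / 4) v +
          ENNReal.ofReal ((1 / r₀) ^ 2) * pressureD 0 1 q := add_le_add (add_le_add hE hA) hD
      _ ≤ (a₀ : ℝ≥0∞) * dissipationE 0 (3 / 4) G + (a₀ : ℝ≥0∞) * energyA 0 (3 / 4) v +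
          (a₀ : ℝ≥0∞) * pressureD 0 1 q := by gcongr
      _ = (a₀ : ℝ≥0∞) * (energyA 0 (3 / 4) v + dissipationE 0 (3 / 4) G + pressureD 0 1 q) := by ring
      _ ≤ (a₀ : ℝ≥0∞) * M' := mul_le_mul' le_rfl hdata
  -- the contraction `ℰ(ϑ s) ≤ ½ ℰ(s) + B` on `(0, 1/4)`
  have hstep : ∀ s, 0 < s → s < 1 / 4 →
      dissipationE z ((ϑ : ℝ) * s) G + energyA z ((ϑ : ℝ) * s) v + pressureD z ((ϑ : ℝ) * s) q ≤
        2⁻¹ * (dissipationE z s G + energyA z s v + pressureD z s q) + B := by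
    intro s hs0 hsR
    refine decay_step_half (E := fun s => dissipationE z s G) (A := fun s => energyA z s v)
      (C := fun s => cubicC z s v) (D := fun s => pressureD z s q) hϑ0 hϑ4 hLϑ hLε h11
      (fun s hs => ?_) (fun s hs κ hκ hκ1 => ?_)
      (fun s hs κ hκ hκ1 => cubicC_mul_le _ v hs.1 hκ hκ1) ⟨hs0, hsR⟩
    · have hsub : parCyl z s ⊆ ((parCylOpens 0 1 : Opens (ℝ × EuclideanSpace ℝ (Fin 3))) :
          Set (ℝ × EuclideanSpace ℝ (Fin 3))) := by
        rw [coe_parCylOpens]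
        exact parCyl_axis_subset hs.1.le (by rw [abs_zero]; linarith [hs.2])
      exact (h12 _ v q G hsw hv3loc hG z s hs.1 hsub).trans (by gcongr)
    · exact (pressureD_mul_le_of_decay (h13 v q hdist) hs hκ hκ1).trans (by gcongr)
  -- `ℰ ≤ 2⁻ⁿ a₀ M' + 2B ≤ 1 + 2B` on `(0, ϑⁿ/4)`
  have hΦ : dissipationE z r G + energyA z r v + pressureD z r q ≤ 1 + 2 * B := by
    have h1 := iterate_halving_pow (Φ := fun s => dissipationE z s G + energyA z s v + pressureD z s q)
      (R := 1 / 4) hϑR hϑ1R hr₀0 le_rfl hstep htop n r hr.1 hrn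
    exact h1.trans (add_le_add hn le_rfl)
  -- conclusion at the given `r`
  have h2 := h11 r hrI
  rw [hz0] at hΦ h2
  calc energyA 0 r v + dissipationE 0 r G + cubicC 0 r v + pressureD 0 r q
      = (dissipationE 0 r G + energyA 0 r v + pressureD 0 r q) + cubicC 0 r v := by ring
    _ ≤ (1 + 2 * B) + (ε * (dissipationE 0 r G + energyA 0 r v) + F) := add_le_add hΦ h2
    _ ≤ (1 + 2 * B) + (ε * (1 + 2 * B) + F) := by
        have hEA : dissipationE 0 r G + energyA 0 r v ≤ 1 + 2 * B := le_self_add.trans hΦ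
        gcongr (1 + 2 * (B : ℝ≥0∞)) + ((ε : ℝ≥0∞) * ?_ + (F : ℝ≥0∞))
    _ = (((1 + ε) * (1 + 2 * B) + F : ℝ≥0) : ℝ≥0∞) := by
        push_cast; ring

end Summit.NavierStokesRegularity.NavierStokesRegularity.Theorems

end
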